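import Summits.Ventures.Crystal3D.Theorems.StickyWulffConstantCoaxialWallLawWordNoTop
import HarnessLib

/-!
# Word rigidity, glide form: no well-formed word has the slot dozen mirrored across a GLIDE normal of another word

HONEST FRAMING. Part of the venture `Summits/Ventures/Crystal3D` (cell `crystal3d-full`), helper for the crux
`CoaxialWallLaw` (stmt-Ventures-19481) of `route-Ventures-StickyWulffConstant`, REGISTERED line `WallLedgerF`
(planner cf-p1 gen 16), open stub `stub_coaxialTwoSlabAdhesion` (general fillings).  Rung credit only; F-C1 not
moved.  Input of the SHARP end multiplicity of the exact end accounting (memo F-CONSTANT-g6 §3): at a ball that READS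
AS A TWIN DOZEN of `(F κ, m)` with `⟪d κ, m⟫ = 0` (a GLIDE reading), the only candidate for a second certified class
is a word whose frame maps the slots onto the mirrored dozen `(F κ ∘ R_μ) '' fccSlots`, `μ = (F κ)⁻¹ m`
(`word_class_of_twinDozen`, `…EndClasses`).  This file shows that NO well-formed word does so — the generalisation of
`word_image_ne_mirror_of_inner_zero` (`…WordNoTop`, the case `κ = []`) to an arbitrary well-formed `κ`:

**Theorem (`word_image_ne_cons_of_inner_zero`).**  Word data `F, u, WF` as in `…WordLetters` (`hFc`, `huc`,
`hWFc`); `κ₀` well formed, `μ` a unit model menu normal with `⟪u κ₀, μ⟫ = 0`.  Then for every well-formed `κ`,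
`F κ '' fccSlots ≠ F (μ :: κ₀) '' fccSlots` (the list `μ :: κ₀` is not well formed — it would need
`⟪u κ₀, μ⟫ = +√(2/3)` — but its frame `F κ₀ ∘ R_μ` is defined by `hFc`).  Proof = the proof of `word_eq_of_image_eq`
(`…WordRigidity`): split off the longest common suffix `τ` of `κ` and `μ :: κ₀`; the glued mirror chain
`α ++ α'.reverse` maps the slots into the slots, is a `±1/3`-chain of unit model menu normals (at the junction the two
deepest letters pair with `u τ` to `+√(2/3)` resp. to `+√(2/3)` or, when the deepest letter of `α'` is `μ` itself, to
`0` — so they are neither equal nor antipodal; the letter `μ` chains with the head of `κ₀` for the same reason), hence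
empty by `foldl_reflect_slots_false` (`…ModelChain`, the 3-adic non-return) — and then `κ = μ :: κ₀` would be well
formed.  Frame form: `word_image_ne_glideMirror` (`F κ' '' fccSlots ≠ (x ↦ F κ (x − 2⟪x, μ⟫ μ)) '' fccSlots`).

WHAT THIS IS NOT: not the stub; F-C1 not moved.
-/

noncomputable section

namespace Summit.Ventures.Crystal3D.Theorems

open Summit.Ventures.Crystal3D Finset
open Literature.MathematicalPhysics.StatisticalMechanics (fccStacking)
open scoped InnerProductSpace

section NoGlide

variable {F : List (EuclideanSpace ℝ (Fin 3)) → (EuclideanSpace ℝ (Fin 3) ≃ₗᵢ[ℝ] EuclideanSpace ℝ (Fin 3))}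
  {u : List (EuclideanSpace ℝ (Fin 3)) → EuclideanSpace ℝ (Fin 3)}
  {WF : List (EuclideanSpace ℝ (Fin 3)) → Prop}

/-- Two DISTINCT, NON-ANTIPODAL unit model menu normals meet at `⟪·,·⟫ = ±1/3`. -/
theorem menuNormals_chain_of_ne_of_ne_neg {x y : EuclideanSpace ℝ (Fin 3)} (hx1 : ‖x‖ = 1) (hy1 : ‖y‖ = 1)
    (hxm : ∀ w ∈ fccSlots, ⟪w, x⟫_ℝ = 0 ∨ ⟪w, x⟫_ℝ = Real.sqrt (2 / 3) ∨ ⟪w, x⟫_ℝ = -Real.sqrt (2 / 3))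
    (hym : ∀ w ∈ fccSlots, ⟪w, y⟫_ℝ = 0 ∨ ⟪w, y⟫_ℝ = Real.sqrt (2 / 3) ∨ ⟪w, y⟫_ℝ = -Real.sqrt (2 / 3))
    (hxy : x ≠ y) (hxy' : y ≠ -x) :
    ⟪x, y⟫_ℝ = 1 / 3 ∨ ⟪x, y⟫_ℝ = -1 / 3 := by
  have hmx : ∀ w ∈ fccSlots,
      ⟪(LinearIsometryEquiv.refl ℝ (EuclideanSpace ℝ (Fin 3))) w, x⟫_ℝ = 0 ∨
      ⟪(LinearIsometryEquiv.refl ℝ (EuclideanSpace ℝ (Fin 3))) w, x⟫_ℝ = Real.sqrt (2 / 3) ∨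
      ⟪(LinearIsometryEquiv.refl ℝ (EuclideanSpace ℝ (Fin 3))) w, x⟫_ℝ = -Real.sqrt (2 / 3) := by
    intro w hw; simpa using hxm w hw
  have hmy : ∀ w ∈ fccSlots,
      ⟪(LinearIsometryEquiv.refl ℝ (EuclideanSpace ℝ (Fin 3))) w, y⟫_ℝ = 0 ∨
      ⟪(LinearIsometryEquiv.refl ℝ (EuclideanSpace ℝ (Fin 3))) w, y⟫_ℝ = Real.sqrt (2 / 3) ∨
      ⟪(LinearIsometryEquiv.refl ℝ (EuclideanSpace ℝ (Fin 3))) w, y⟫_ℝ = -Real.sqrt (2 / 3) := by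
    intro w hw; simpa using hym w hw
  rcases inner_menuNormals (LinearIsometryEquiv.refl ℝ _) hx1 hy1 hmx hmy with h | h | h | h
  · exact absurd ((inner_eq_one_iff_of_norm_eq_one (𝕜 := ℝ) hx1 hy1).1 h) hxy
  · exact absurd (eq_neg_of_inner_eq_neg_one' hx1 hy1 h) hxy'
  · exact Or.inl h
  · exact Or.inr h

/-- **No well-formed word has the slot dozen of `μ :: κ₀` for a glide letter `μ` of `κ₀`.**  See the module
docstring. -/
theorem word_image_ne_cons_of_inner_zero
    (hFc : ∀ μ κ, F (μ :: κ) = ((ℝ ∙ μ)ᗮ.reflection).trans (F κ))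
    (huc : ∀ μ κ, u (μ :: κ) = -u κ)
    (hWFc : ∀ μ κ, WF (μ :: κ) ↔ (WF κ ∧ ‖μ‖ = 1 ∧
      (∀ w ∈ fccSlots, ⟪w, μ⟫_ℝ = 0 ∨ ⟪w, μ⟫_ℝ = Real.sqrt (2 / 3) ∨ ⟪w, μ⟫_ℝ = -Real.sqrt (2 / 3)) ∧
      ⟪u κ, μ⟫_ℝ = Real.sqrt (2 / 3) ∧ ∀ μ' κ', κ = μ' :: κ' → μ' ≠ -μ))
    {κ₀ : List (EuclideanSpace ℝ (Fin 3))} (hκ₀ : WF κ₀)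
    {μ : EuclideanSpace ℝ (Fin 3)} (hμ : ‖μ‖ = 1)
    (hμmenu : ∀ w ∈ fccSlots, ⟪w, μ⟫_ℝ = 0 ∨ ⟪w, μ⟫_ℝ = Real.sqrt (2 / 3) ∨ ⟪w, μ⟫_ℝ = -Real.sqrt (2 / 3))
    (horth : ⟪u κ₀, μ⟫_ℝ = 0)
    {κ : List (EuclideanSpace ℝ (Fin 3))} (hκ : WF κ) :
    (F κ : EuclideanSpace ℝ (Fin 3) → EuclideanSpace ℝ (Fin 3)) '' ↑fccSlots ≠
      (F (μ :: κ₀) : EuclideanSpace ℝ (Fin 3) → EuclideanSpace ℝ (Fin 3)) '' ↑fccSlots := by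
  intro himg
  have hr : 0 < Real.sqrt (2 / 3) := Real.sqrt_pos.2 (by norm_num)
  -- `μ :: κ₀` is not well formed
  have hnotWF : ¬ WF (μ :: κ₀) := by
    intro h
    have := ((hWFc μ κ₀).1 h).2.2.2.1
    rw [horth] at this
    exact absurd this (ne_of_lt hr)
  -- letters and chains
  obtain ⟨hlet, hchain⟩ := word_letters_of_wf huc hWFc _ hκ
  obtain ⟨hlet₀, hchain₀⟩ := word_letters_of_wf huc hWFc _ hκ₀
  have hlet' : ∀ ν ∈ μ :: κ₀, ‖ν‖ = 1 ∧
      ∀ w ∈ fccSlots, ⟪w, ν⟫_ℝ = 0 ∨ ⟪w, ν⟫_ℝ = Real.sqrt (2 / 3) ∨ ⟪w, ν⟫_ℝ = -Real.sqrt (2 / 3) := by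
    intro ν hν
    rcases List.mem_cons.1 hν with rfl | hν
    · exact ⟨hμ, hμmenu⟩
    · exact hlet₀ ν hν
  -- the chain of `μ :: κ₀`: `μ` is neither the head letter of `κ₀` nor its opposite
  have hchain' : List.IsChain (fun μ μ' => ⟪μ, μ'⟫_ℝ = 1 / 3 ∨ ⟪μ, μ'⟫_ℝ = -1 / 3) (μ :: κ₀) := by
    rw [List.isChain_cons]
    refine ⟨fun b hb => ?_, hchain₀⟩
    obtain ⟨κ₁, rfl⟩ : ∃ κ₁, κ₀ = b :: κ₁ := by
      cases κ₀ with
      | nil => simp at hb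
      | cons a l => simp at hb; exact ⟨l, by rw [hb]⟩
    obtain ⟨-, hb1, hbmenu, hbu, -⟩ := (hWFc b κ₁).1 hκ₀
    rw [huc, inner_neg_left] at horth
    have h0 : ⟪u κ₁, μ⟫_ℝ = 0 := by linarith
    refine menuNormals_chain_of_ne_of_ne_neg hμ hb1 hμmenu hbmenu ?_ ?_
    · intro hμb; rw [← hμb, h0] at hbu; exact absurd hbu (ne_of_lt hr)
    · intro hbμ; rw [hbμ, inner_neg_right, h0, neg_zero] at hbu; exact absurd hbu (ne_of_lt hr)
  -- the common suffix
  obtain ⟨α, α', τ, hκα, hκ'α, hne⟩ := exists_common_suffix κ (μ :: κ₀)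
  have hαu : ∀ ν ∈ α, ‖ν‖ = 1 := fun ν hν => (hlet ν (by rw [hκα]; exact List.mem_append_left τ hν)).1
  have hα'u : ∀ ν ∈ α', ‖ν‖ = 1 := fun ν hν => (hlet' ν (by rw [hκ'α]; exact List.mem_append_left τ hν)).1
  -- it suffices that the glued list `α ++ α'.reverse` is empty
  suffices h : α ++ α'.reverse = [] by
    obtain ⟨h1, h2⟩ := List.append_eq_nil_iff.1 h
    rw [h1, List.nil_append] at hκα
    rw [List.reverse_eq_nil_iff.1 h2, List.nil_append] at hκ'α
    rw [hκα, ← hκ'α] at hκ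
    exact hnotWF hκ
  by_contra hL
  refine foldl_reflect_slots_false (α ++ α'.reverse) hL ?_ ?_ ?_
  · -- letters: unit model menu normals
    intro ν hν
    rcases List.mem_append.1 hν with h | h
    · exact hlet ν (by rw [hκα]; exact List.mem_append_left τ h)
    · exact hlet' ν (by rw [hκ'α]; exact List.mem_append_left τ (List.mem_reverse.1 h))
  · -- the chain condition
    rw [List.isChain_append]
    have hc1 : List.IsChain (fun μ μ' => ⟪μ, μ'⟫_ℝ = 1 / 3 ∨ ⟪μ, μ'⟫_ℝ = -1 / 3) (α ++ τ) := by rw [← hκα]; exact hchain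
    have hc2 : List.IsChain (fun μ μ' => ⟪μ, μ'⟫_ℝ = 1 / 3 ∨ ⟪μ, μ'⟫_ℝ = -1 / 3) (α' ++ τ) := by rw [← hκ'α]; exact hchain'
    refine ⟨hc1.left_of_append, ?_, ?_⟩
    · rw [List.isChain_reverse]
      exact hc2.left_of_append.imp fun a b h => by rw [real_inner_comm]; exact h
    · intro x hx y hy
      rw [List.head?_reverse] at hy
      have hxy : x ≠ y := hne x hx y hy
      obtain ⟨hx1, hxm⟩ := hlet x (by rw [hκα]; exact List.mem_append_left τ (List.mem_of_getLast? hx))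
      obtain ⟨hy1, hym⟩ := hlet' y (by rw [hκ'α]; exact List.mem_append_left τ (List.mem_of_getLast? hy))
      have hκατ : WF (α ++ τ) := by rw [← hκα]; exact hκ
      have hux : ⟪u τ, x⟫_ℝ = Real.sqrt (2 / 3) := word_inner_u_getLast hWFc α τ hκατ x hx
      -- `y` pairs with `u τ` to `+√(2/3)` (a letter of `κ₀`) or to `0` (`y = μ`, `τ = κ₀`)
      have huy : ⟪u τ, y⟫_ℝ = Real.sqrt (2 / 3) ∨ ⟪u τ, y⟫_ℝ = 0 := by
        -- `α' = μ :: β` with `κ₀ = β ++ τ`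
        have hα'ne : α' ≠ [] := by intro h; rw [h] at hy; simp at hy
        obtain ⟨b, β, rfl⟩ := List.exists_cons_of_ne_nil hα'ne
        rw [List.cons_append] at hκ'α
        obtain ⟨hbμ, hκ₀β⟩ := List.cons.inj hκ'α
        cases β with
        | nil =>
          right
          have : y = b := by simpa using hy.symm
          rw [this, ← hbμ, ← hκ₀β.trans (List.nil_append τ)]
          exact horth
        | cons c γ =>
          left
          have hy' : y ∈ (c :: γ).getLast? := by
            rw [List.getLast?_cons_cons] at hy; exact hy
          have hκ₀' : WF ((c :: γ) ++ τ) := by rw [← hκ₀β]; exact hκ₀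
          exact word_inner_u_getLast hWFc (c :: γ) τ hκ₀' y hy'
      refine menuNormals_chain_of_ne_of_ne_neg hx1 hy1 hxm hym hxy ?_
      intro hyx
      rw [hyx, inner_neg_right, hux] at huy
      rcases huy with h | h
      · linarith
      · linarith
  · -- the glued mirror chain maps the slots into the slots
    intro w hw
    have hmem : (F (α ++ τ) : EuclideanSpace ℝ (Fin 3) → EuclideanSpace ℝ (Fin 3)) w ∈
        (F (α' ++ τ) : EuclideanSpace ℝ (Fin 3) → EuclideanSpace ℝ (Fin 3)) '' ↑fccSlots := by
      rw [← hκα, ← hκ'α, ← himg]; exact Set.mem_image_of_mem _ (Finset.mem_coe.2 hw)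
    obtain ⟨w', hw', heq⟩ := hmem
    rw [Finset.mem_coe] at hw'
    rw [word_F_append_apply hFc α hαu, word_F_append_apply hFc α' hα'u] at heq
    have heq' := (F τ).injective heq
    have key := foldl_reflect_reverse_foldl α' hα'u w'
    rw [heq', ← List.foldl_append] at key
    rw [key]; exact hw'

/-- **Frame form** (the `hnoglide` input of the sharp end multiplicity): for well-formed `κ, κ'` and a unit model
menu normal `μ` with `⟪u κ, μ⟫ = 0`, the slot dozen of `F κ'` is not the `μ`-mirrored slot dozen of `F κ`. -/
theorem word_image_ne_glideMirror
    (hFc : ∀ μ κ, F (μ :: κ) = ((ℝ ∙ μ)ᗮ.reflection).trans (F κ))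
    (huc : ∀ μ κ, u (μ :: κ) = -u κ)
    (hWFc : ∀ μ κ, WF (μ :: κ) ↔ (WF κ ∧ ‖μ‖ = 1 ∧
      (∀ w ∈ fccSlots, ⟪w, μ⟫_ℝ = 0 ∨ ⟪w, μ⟫_ℝ = Real.sqrt (2 / 3) ∨ ⟪w, μ⟫_ℝ = -Real.sqrt (2 / 3)) ∧
      ⟪u κ, μ⟫_ℝ = Real.sqrt (2 / 3) ∧ ∀ μ' κ', κ = μ' :: κ' → μ' ≠ -μ))
    {κ : List (EuclideanSpace ℝ (Fin 3))} (hκ : WF κ)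
    {μ : EuclideanSpace ℝ (Fin 3)} (hμ : ‖μ‖ = 1)
    (hμmenu : ∀ w ∈ fccSlots, ⟪w, μ⟫_ℝ = 0 ∨ ⟪w, μ⟫_ℝ = Real.sqrt (2 / 3) ∨ ⟪w, μ⟫_ℝ = -Real.sqrt (2 / 3))
    (horth : ⟪u κ, μ⟫_ℝ = 0)
    {κ' : List (EuclideanSpace ℝ (Fin 3))} (hκ' : WF κ') :
    (F κ' : EuclideanSpace ℝ (Fin 3) → EuclideanSpace ℝ (Fin 3)) '' ↑fccSlots ≠
      (fun x => F κ (x - (2 * ⟪x, μ⟫_ℝ) • μ)) '' ↑fccSlots := by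
  have h := word_image_ne_cons_of_inner_zero hFc huc hWFc hκ hμ hμmenu horth hκ'
  have e : (fun x => F κ (x - (2 * ⟪x, μ⟫_ℝ) • μ)) =
      (F (μ :: κ) : EuclideanSpace ℝ (Fin 3) → EuclideanSpace ℝ (Fin 3)) := by
    funext x; exact (word_F_cons_apply hFc hμ κ x).symm
  rw [e]; exact h

end NoGlide

end Summit.Ventures.Crystal3D.Theorems

end
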